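import Literature.Analysis.FluidPDE.TorusNSSobolevLifespan
import Literature.Analysis.FluidPDE.TorusNSLebesgueTimeAverages
import Literature.Analysis.FluidPDE.TorusNSFoiasGuillopeTemamH3
import Literature.Analysis.FluidPDE.TorusNSSobolevHighRange
import HarnessLib

/-!
# A priori time-integrated `Ḣ^s` bounds for classical Navier–Stokes solutions on `T³`:
# `∫₀ᵀ ‖u‖_{Ḣ^s}^{2/s} ≤ ‖u₀‖₂^{2/s}/(8π²ν)` (`0 < s < 1`) and the Foias–Guillopé–Temam scale
# `∫₀ᵀ ‖u‖_{Ḣ^s}^{2/(2s−1)} ≤ C(ν, ‖u₀‖₂, T)` (`1 < s < 2`, `2 < s < 3`)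

Analysis/FluidPDE support file (theorems only; no definitions, no named facts).
Search for candidate a priori estimates; no regularity claim.

The energy class `L^∞(0,T; L²) ∩ L²(0,T; Ḣ¹)` interpolates (Robinson–Rodrigo–Sadowski 2016,
Lemma 1.15 (1.22): `‖u‖_{Ḣ^s} ≤ ‖u‖_{L²}^{1−s} ‖u‖_{Ḣ¹}^{s}`, `0 < s < 1`) to
`u ∈ L^{2/s}(0, T; Ḣ^s)` (and the `H¹`–`H²` a priori rungs interpolate to
`u ∈ L^{2/(2s−1)}(0,T; Ḣ^s)`, `1 < s < 2`) — the Sobolev-scale sibling of the Lebesgue-scale Lemma 3.5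
(`u ∈ L^r(0,T;L^q)`, `2/r + 3/q = 3/2`) and of the time-integrated `L^q` bounds of
`TorusNSLebesgueTimeAverages` (Kang–Protas (6), Gibbon's chessboard square `(0, m)`). Here, for
classical solutions of the unforced system on `[0, T] × T³` (`Torus.IsClassicalNSSolutionOn`, any
mean), with `‖u‖²_{Ḣ^s} := ∑_k |k|^{2s}‖û(k)‖²` (`|k|² = freqNormSq k`) and the energy inequality
`∫₀ᵀ ‖∇u‖₂² ≤ ‖u(0)‖₂²/(2ν)` (`Torus.classicalNS_integral_gradNormSq_le`, `‖∇u‖₂² = 4π² ∑|k|²‖û‖²`):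

* `NSSobolev.tsum_rpow_mul_norm_sq_le_energy_interpolate` — for a smooth field,
  `∑|k|^{2s}‖û‖² ≤ (∫‖u‖²)^{1−s} (‖∇u‖₂²/(4π²))^{s}`;
* `NSSobolev.classicalNS_integral_hsSeminorm_rpow_le` — **the a priori bound**
  `∫₀ᵀ (∑_k |k|^{2s}‖û(t,k)‖²)^{1/s} dt ≤ (∫‖u(0)‖²)^{1/s} / (8π²ν)`, `0 < s < 1`;
* `NSSobolev.tsum_rpow_mul_norm_sq_le_enstrophy_interpolate` — for a smooth field and `1 < s < 2`,
  `∑|k|^{2s}‖û‖² ≤ (‖∇u‖₂²/(4π²))^{2−s} (‖Δu‖₂²/(16π⁴))^{s−1}`;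
* `NSSobolev.classicalNS_integral_hsSeminorm_rpow_le_of_one_lt` — **the Foias–Guillopé–Temam
  scale**, `1 < s < 2` (mean-zero slices): `∫₀ᵀ (∑_k |k|^{2s}‖û(t,k)‖²)^{1/(2s−1)} dt ≤`
  `(1/(4π²))^{s/(2s−1)} (1/ν + 27‖u(0)‖₂²/(8π⁴ν⁵))^{(s−1)/(2s−1)} (T + ‖u(0)‖₂²/(2ν))^{s/(2s−1)}`
  — the fractional squares between the enstrophy rung and the FGT rung `∫₀ᵀ‖Δu‖₂^{2/3}`
  (`Torus.classicalNS_integral_laplacian_twoThirds_le`), by Hölder in time against the tree's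
  weighted dissipation bound `Torus.classicalNS_integral_laplacianSq_div_sq_le`;
* `NSSobolev.tsum_rpow_mul_norm_sq_le_laplacian_interpolate`,
  `NSSobolev.classicalNS_integral_hsSeminorm_rpow_le_of_two_lt` — the same on `2 < s < 3`, between
  the FGT rungs `H²` and `H³` (`Torus.classicalNS_integral_gradNormSq_laplacian_div_le`,
  `TorusNSFoiasGuillopeTemamH3`): `∫₀ᵀ ‖u‖_{Ḣ^s}^{2/(2s−1)} ≤ (1/(4π²))^{s/(2s−1)} (W₃/ν)^{(s−2)/(2s−1)} (T + B₂)^{(s+1)/(2s−1)}`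
  (continuity of the `Ḣ^s` sum for `s < 9/2` from `TorusNSSobolevHighRange`).

## Mathlib / tree search

Tree: `Torus.tsum_rpow_mul_le_interpolate` (`TorusWienerSobolevInterpolation`, RRS Lemma 1.15),
`hasSum_sq_norm_mFourierCoeff_complexify` (Parseval), `NSGevrey.hasSum_freqNormSq_mul_norm_sq_mFourierCoeff`
(spectral enstrophy), `kineticEnergy_le_of_le` (energy decay), `Torus.classicalNS_integral_gradNormSq_le`,
`NSSobolev.continuousOn_tsum_rpow_mul_norm_sq` (`TorusNSSobolevLifespan`). Searched
`hsSeminorm.*integral.*le|rpow_mul_norm_sq.*intervalIntegral`: no time-integrated fractional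
Sobolev bound in the tree.

## References

* J. C. Robinson, J. L. Rodrigo, W. Sadowski, *The Three-Dimensional Navier–Stokes Equations*,
  CUP 2016, Lemma 1.15 (1.22) (p. 33), the energy equality (3.2) for classical solutions
  (p. 59), Lemma 3.5 (p. 61), Lemma 8.15 (8.6) (p. 129) (held:
  book:robinson2016-three-dimensional-navier-stokes-equations-classical-theory, pp. 33, 59, 61, 129).
  [RobinsonRodrigoSadowskiCUP2016]
* D. Kang, B. Protas, *Searching for singularities in Navier–Stokes flows based on the
  Ladyzhenskaya–Prodi–Serrin conditions*, J. Nonlinear Sci. 32 (2022), eq. (6), App. A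
  (the `L^q` sibling). [KangProtas2022]
* C. Foias, C. Guillopé, R. Temam, *New a priori estimates for Navier–Stokes equations in
  dimension 3*, Comm. PDE 6 (1981) 329–359, Thm 3.1; RRS 2016 Lemma 8.15 (8.6) (held: p. 129).
  [FoiasGuillopeTemam1981]
* J. D. Gibbon, *Weak and strong solutions of the 3D Navier–Stokes equations and their relation to
  a chessboard of convergent inverse length scales*, J. Nonlinear Sci. 29 (2019), App. A (A.1).
  [Gibbon2019Chessboard]
-/

noncomputable section

open MeasureTheory Set Filter UnitAddTorus Function Finset
open scoped Topology BigOperators InnerProductSpace ComplexConjugate ENNReal NNReal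

namespace Literature.Analysis.FluidPDE

namespace NSSobolev

open Literature.Analysis.FunctionSpaces Literature.Analysis.FunctionSpaces.Torus NSGevrey

variable {d : Type*} [Fintype d] [DecidableEq d]

/-! ### §1 The energy-class interpolation of the `Ḣ^s` seminorm, `0 < s < 1` -/

/-- **`‖u‖²_{Ḣ^s} ≤ ‖u‖₂^{2(1−s)} (‖∇u‖₂²/(4π²))^{s}`** for a smooth field on `T^n` and `0 < s < 1`
(Robinson–Rodrigo–Sadowski 2016, Lemma 1.15 (1.22) with `s₁ = 0`, `s₂ = 1`, `θ = 1 − s`, read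
through Parseval `∑‖û‖² = ∫‖u‖²` and `4π²∑|k|²‖û‖² = ‖∇u‖₂²`).
[cite: RobinsonRodrigoSadowskiCUP2016, Lemma 1.15 (1.22)] -/
theorem tsum_rpow_mul_norm_sq_le_energy_interpolate {u : UnitAddTorus d → EuclideanSpace ℝ d}
    (hu : IsSmooth u) {s : ℝ} (hs0 : 0 < s) (hs1 : s < 1) :
    ∑' k : d → ℤ, freqNormSq k ^ s * ‖mFourierCoeff (EuclideanSpace.complexify ∘ u) k‖ ^ 2 ≤
      (∫ x, ‖u x‖ ^ 2) ^ (1 - s) * (Torus.gradNormSq u / (4 * Real.pi ^ 2)) ^ s := by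
  classical
  set a : (d → ℤ) → ℝ := fun k => ‖mFourierCoeff (EuclideanSpace.complexify ∘ u) k‖ ^ 2 with ha
  have ha0 : ∀ k, 0 ≤ a k := fun k => sq_nonneg _
  have hP : HasSum a (∫ x, ‖u x‖ ^ 2) := hasSum_sq_norm_mFourierCoeff_complexify (hu.memLp 2)
  have hG := hasSum_freqNormSq_mul_norm_sq_mFourierCoeff hu
  -- `∑ |k|² ‖û‖² = ‖∇u‖₂² / (4π²)`
  have hG' : HasSum (fun k : d → ℤ => freqNormSq k * a k)
      (Torus.gradNormSq u / (4 * Real.pi ^ 2)) := by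
    have h := hG.mul_left (1 / (4 * Real.pi ^ 2))
    rw [show Torus.gradNormSq u / (4 * Real.pi ^ 2) = 1 / (4 * Real.pi ^ 2) * Torus.gradNormSq u by
      ring]
    refine h.congr_fun fun k => ?_
    simp only [ha]
    field_simp
  have h₁ : Summable fun k : d → ℤ => freqNormSq k ^ (0 : ℝ) * a k :=
    hP.summable.congr fun k => by rw [Real.rpow_zero, one_mul]
  have h₂ : Summable fun k : d → ℤ => freqNormSq k ^ (1 : ℝ) * a k :=
    hG'.summable.congr fun k => by rw [Real.rpow_one]
  obtain ⟨-, hle⟩ := tsum_rpow_mul_le_interpolate (d := d) ha0 (s₁ := 0) (s₂ := 1) (θ := 1 - s)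
    le_rfl zero_lt_one (by linarith) (by linarith) h₁ h₂
  have e : (1 - s) * 0 + (1 - (1 - s)) * 1 = s := by ring
  rw [e] at hle
  have e₁ : ∑' k : d → ℤ, freqNormSq k ^ (0 : ℝ) * a k = ∫ x, ‖u x‖ ^ 2 := by
    rw [tsum_congr fun k => by rw [Real.rpow_zero, one_mul]]
    exact hP.tsum_eq
  have e₂ : ∑' k : d → ℤ, freqNormSq k ^ (1 : ℝ) * a k = Torus.gradNormSq u / (4 * Real.pi ^ 2) := by
    rw [tsum_congr fun k => by rw [Real.rpow_one]]
    exact hG'.tsum_eq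
  rw [e₁, e₂, show (1 : ℝ) - (1 - s) = s by ring] at hle
  exact hle

/-! ### §2 The time-integrated bound -/

/-- Along a classical solution on `[a, b]`, `t ↦ ‖∇u(t)‖₂²` is continuous. [folklore] -/
private theorem continuousOn_gradNormSq' {ν a b : ℝ} (hab : a < b)
    {f u : ℝ → UnitAddTorus d → EuclideanSpace ℝ d} {p : ℝ → UnitAddTorus d → ℝ}
    (h : Torus.IsClassicalNSSolutionOn (Icc a b) ν f u p) :
    ContinuousOn (fun t => Torus.gradNormSq (u t)) (Icc a b) := by
  intro t ht
  have h1 : ContinuousWithinAt (fun s => (2 : ℝ) * (2⁻¹ * Torus.gradNormSq (u s))) (Icc a b) t :=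
    continuousWithinAt_const.mul (h.hasDerivWithinAt_half_gradNormSq hab ht).continuousWithinAt
  refine h1.congr (fun s _ => ?_) ?_ <;> ring

/-- **A priori time-integrated `Ḣ^s` bound, `0 < s < 1`** (the `Ḣ^s` form of the energy-class
interpolation, Robinson–Rodrigo–Sadowski 2016 Lemma 1.15 with the energy equality (3.2);
Sobolev-scale sibling of Lemma 3.5 and of Kang–Protas (6)): on `T³` (`card d = 3`), for every
classical solution of the unforced Navier–Stokes equations with `ν > 0` on `[0, T] × T³`, `T > 0`,
`∫₀ᵀ (∑_k |k|^{2s} ‖û(t,k)‖²)^{1/s} dt ≤ (∫ ‖u(0)‖²)^{1/s} / (8π²ν)`,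
i.e. `∫₀ᵀ ‖u(t)‖_{Ḣ^s}^{2/s} dt ≤ ‖u₀‖_{L²}^{2/s}/(8π²ν)` in the tree's normalisation
(`∑|k|^{2s}‖û‖² ≤ ‖u‖₂^{2(1−s)}(‖∇u‖₂²/4π²)^s`, energy decay `‖u(t)‖₂ ≤ ‖u(0)‖₂`, and
`∫₀ᵀ‖∇u‖₂² ≤ ‖u(0)‖₂²/(2ν)`). A bound valid A PRIORI for every classical solution (no smallness),
scale-critical at no `s` (the exponent pair `(2/s, Ḣ^s)` is energy-class).
[cite: RobinsonRodrigoSadowskiCUP2016, Lemma 1.15 (1.22) with (3.2) / Lemma 3.5] -/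
theorem classicalNS_integral_hsSeminorm_rpow_le (hd : Fintype.card d = 3) {s : ℝ} (hs0 : 0 < s)
    (hs1 : s < 1) {ν T : ℝ} (hν : 0 < ν) (hT : 0 < T)
    {u : ℝ → UnitAddTorus d → EuclideanSpace ℝ d} {p : ℝ → UnitAddTorus d → ℝ}
    (h : Torus.IsClassicalNSSolutionOn (Icc 0 T) ν 0 u p) :
    ∫ t in (0 : ℝ)..T, (∑' k : d → ℤ, freqNormSq k ^ s *
        ‖mFourierCoeff (EuclideanSpace.complexify ∘ u t) k‖ ^ 2) ^ (1 / s) ≤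
      (∫ x, ‖u 0 x‖ ^ 2) ^ (1 / s) / (8 * Real.pi ^ 2 * ν) := by
  classical
  have hn : (Fintype.card d : ℝ) = 3 := by rw [hd]; norm_num
  set X : ℝ → ℝ := fun t => ∑' k : d → ℤ, freqNormSq k ^ s *
    ‖mFourierCoeff (EuclideanSpace.complexify ∘ u t) k‖ ^ 2 with hX
  set E₀ : ℝ := ∫ x, ‖u 0 x‖ ^ 2 with hE₀
  have hE₀0 : 0 ≤ E₀ := integral_nonneg fun x => sq_nonneg _
  have hXnn : ∀ t, 0 ≤ X t := fun t => tsum_nonneg fun k =>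
    mul_nonneg (Real.rpow_nonneg (freqNormSq_nonneg k) _) (sq_nonneg _)
  -- ### pointwise: `X(t)^{1/s} ≤ E₀^{(1−s)/s} ‖∇u(t)‖₂² / (4π²)`
  have hpt : ∀ t ∈ Icc 0 T, X t ^ (1 / s) ≤
      E₀ ^ ((1 - s) / s) / (4 * Real.pi ^ 2) * Torus.gradNormSq (u t) := by
    intro t ht
    have hut : IsSmooth (u t) := h.smooth_velocity.isSmooth_slice ht
    have h1 := tsum_rpow_mul_norm_sq_le_energy_interpolate hut hs0 hs1
    have hEt0 : 0 ≤ ∫ x, ‖u t x‖ ^ 2 := integral_nonneg fun x => sq_nonneg _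
    have hG0 : 0 ≤ Torus.gradNormSq (u t) / (4 * Real.pi ^ 2) :=
      div_nonneg (Torus.gradNormSq_nonneg _) (by positivity)
    -- energy decay `∫‖u(t)‖² ≤ E₀`
    have hEt : ∫ x, ‖u t x‖ ^ 2 ≤ E₀ := by
      have hK := kineticEnergy_le_of_le hν.le h (convex_Icc 0 T) ht.1
        (fun r hr => ⟨hr.1, hr.2.trans ht.2⟩)
      unfold Torus.kineticEnergy at hK
      rw [hE₀]
      linarith
    have h2 : X t ≤ E₀ ^ (1 - s) * (Torus.gradNormSq (u t) / (4 * Real.pi ^ 2)) ^ s :=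
      h1.trans (mul_le_mul_of_nonneg_right (Real.rpow_le_rpow hEt0 hEt (by linarith))
        (Real.rpow_nonneg hG0 _))
    have hs0' : 0 ≤ 1 / s := by positivity
    calc X t ^ (1 / s) ≤ (E₀ ^ (1 - s) * (Torus.gradNormSq (u t) / (4 * Real.pi ^ 2)) ^ s) ^ (1 / s) :=
          Real.rpow_le_rpow (hXnn t) h2 hs0'
      _ = E₀ ^ ((1 - s) / s) * (Torus.gradNormSq (u t) / (4 * Real.pi ^ 2)) := by
          rw [Real.mul_rpow (Real.rpow_nonneg hE₀0 _) (Real.rpow_nonneg hG0 _),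
            ← Real.rpow_mul hE₀0, ← Real.rpow_mul hG0, mul_one_div_cancel hs0.ne', Real.rpow_one,
            ← div_eq_mul_one_div]
      _ = E₀ ^ ((1 - s) / s) / (4 * Real.pi ^ 2) * Torus.gradNormSq (u t) := by ring
  -- ### integrate in time
  have hXc : ContinuousOn X (Icc 0 T) :=
    continuousOn_tsum_rpow_mul_norm_sq hT h.smooth_velocity hs0 (by rw [hn]; linarith)
  have hXsc : ContinuousOn (fun t => X t ^ (1 / s)) (Icc 0 T) :=
    hXc.rpow_const fun t _ => Or.inr (by positivity)
  have hGc : ContinuousOn (fun t => E₀ ^ ((1 - s) / s) / (4 * Real.pi ^ 2) * Torus.gradNormSq (u t))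
      (Icc 0 T) := continuousOn_const.mul (continuousOn_gradNormSq' hT h)
  have hI1 : IntervalIntegrable (fun t => X t ^ (1 / s)) volume 0 T :=
    (hXsc.mono (by rw [uIcc_of_le hT.le])).intervalIntegrable
  have hI2 : IntervalIntegrable
      (fun t => E₀ ^ ((1 - s) / s) / (4 * Real.pi ^ 2) * Torus.gradNormSq (u t)) volume 0 T :=
    (hGc.mono (by rw [uIcc_of_le hT.le])).intervalIntegrable
  have hmono := intervalIntegral.integral_mono_on hT.le hI1 hI2 hpt
  have hen := Torus.classicalNS_integral_gradNormSq_le hν hT h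
  have hc0 : 0 ≤ E₀ ^ ((1 - s) / s) / (4 * Real.pi ^ 2) := by positivity
  calc ∫ t in (0 : ℝ)..T, X t ^ (1 / s)
      ≤ ∫ t in (0 : ℝ)..T, E₀ ^ ((1 - s) / s) / (4 * Real.pi ^ 2) * Torus.gradNormSq (u t) := hmono
    _ = E₀ ^ ((1 - s) / s) / (4 * Real.pi ^ 2) * ∫ t in (0 : ℝ)..T, Torus.gradNormSq (u t) :=
        intervalIntegral.integral_const_mul _ _
    _ ≤ E₀ ^ ((1 - s) / s) / (4 * Real.pi ^ 2) * (E₀ / (2 * ν)) :=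
        mul_le_mul_of_nonneg_left hen hc0
    _ = E₀ ^ (1 / s) / (8 * Real.pi ^ 2 * ν) := by
        have e : E₀ ^ (1 / s) = E₀ ^ ((1 - s) / s) * E₀ := by
          have e0 : (1 - s) / s + 1 = 1 / s := by
            field_simp
            ring
          rw [← e0, Real.rpow_add' hE₀0 (by rw [e0]; positivity), Real.rpow_one]
        rw [e]
        field_simp
        ring

/-! ### §3 The Foias–Guillopé–Temam scale: `∫₀ᵀ ‖u‖_{Ḣ^s}^{2/(2s−1)}`, `1 < s < 2` -/

/-- **`‖u‖²_{Ḣ^s} ≤ (‖∇u‖₂²/(4π²))^{2−s} (‖Δu‖₂²/(16π⁴))^{s−1}`** for a smooth field on `T^n` and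
`1 < s < 2` (Robinson–Rodrigo–Sadowski 2016, Lemma 1.15 (1.22) with `s₁ = 1`, `s₂ = 2`,
`θ = 2 − s`, read through `4π²∑|k|²‖û‖² = ‖∇u‖₂²` and `16π⁴∑|k|⁴‖û‖² = ‖Δu‖₂²`).
[cite: RobinsonRodrigoSadowskiCUP2016, Lemma 1.15 (1.22)] -/
theorem tsum_rpow_mul_norm_sq_le_enstrophy_interpolate {u : UnitAddTorus d → EuclideanSpace ℝ d}
    (hu : IsSmooth u) {s : ℝ} (hs1 : 1 < s) (hs2 : s < 2) :
    ∑' k : d → ℤ, freqNormSq k ^ s * ‖mFourierCoeff (EuclideanSpace.complexify ∘ u) k‖ ^ 2 ≤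
      (Torus.gradNormSq u / (4 * Real.pi ^ 2)) ^ (2 - s) *
        ((∫ x, ‖Torus.laplacian u x‖ ^ 2) / (16 * Real.pi ^ 4)) ^ (s - 1) := by
  classical
  set a : (d → ℤ) → ℝ := fun k => ‖mFourierCoeff (EuclideanSpace.complexify ∘ u) k‖ ^ 2 with ha
  have ha0 : ∀ k, 0 ≤ a k := fun k => sq_nonneg _
  have hG := hasSum_freqNormSq_mul_norm_sq_mFourierCoeff hu
  have hG' : HasSum (fun k : d → ℤ => freqNormSq k * a k)
      (Torus.gradNormSq u / (4 * Real.pi ^ 2)) := by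
    have h := hG.mul_left (1 / (4 * Real.pi ^ 2))
    rw [show Torus.gradNormSq u / (4 * Real.pi ^ 2) = 1 / (4 * Real.pi ^ 2) * Torus.gradNormSq u by
      ring]
    refine h.congr_fun fun k => ?_
    simp only [ha]
    field_simp
  have hP := hasSum_freqNormSq_sq_mul_norm_sq_mFourierCoeff hu
  have hP' : HasSum (fun k : d → ℤ => freqNormSq k ^ (2 : ℝ) * a k)
      ((∫ x, ‖Torus.laplacian u x‖ ^ 2) / (16 * Real.pi ^ 4)) := by
    have h := hP.mul_left (1 / (16 * Real.pi ^ 4))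
    rw [show (∫ x, ‖Torus.laplacian u x‖ ^ 2) / (16 * Real.pi ^ 4) =
      1 / (16 * Real.pi ^ 4) * ∫ x, ‖Torus.laplacian u x‖ ^ 2 by ring]
    refine h.congr_fun fun k => ?_
    simp only [ha]
    rw [Real.rpow_two]
    field_simp
    ring
  have h₁ : Summable fun k : d → ℤ => freqNormSq k ^ (1 : ℝ) * a k :=
    hG'.summable.congr fun k => by rw [Real.rpow_one]
  have h₂ : Summable fun k : d → ℤ => freqNormSq k ^ (2 : ℝ) * a k := hP'.summable
  obtain ⟨-, hle⟩ := tsum_rpow_mul_le_interpolate (d := d) ha0 (s₁ := 1) (s₂ := 2) (θ := 2 - s)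
    zero_le_one one_lt_two (by linarith) (by linarith) h₁ h₂
  have e : (2 - s) * 1 + (1 - (2 - s)) * 2 = s := by ring
  rw [e] at hle
  have e₁ : ∑' k : d → ℤ, freqNormSq k ^ (1 : ℝ) * a k = Torus.gradNormSq u / (4 * Real.pi ^ 2) := by
    rw [tsum_congr fun k => by rw [Real.rpow_one]]
    exact hG'.tsum_eq
  rw [e₁, hP'.tsum_eq, show (1 : ℝ) - (2 - s) = s - 1 by ring] at hle
  exact hle

/-- Along a classical solution on `[a, b]`, `t ↦ ‖Δu(t)‖₂²` is continuous. [folklore] -/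
private theorem continuousOn_laplacianSq' {ν a b : ℝ} (hab : a < b)
    {f u : ℝ → UnitAddTorus d → EuclideanSpace ℝ d} {p : ℝ → UnitAddTorus d → ℝ}
    (h : Torus.IsClassicalNSSolutionOn (Icc a b) ν f u p) :
    ContinuousOn (fun t => ∫ x, ‖Torus.laplacian (u t) x‖ ^ 2) (Icc a b) := by
  intro t ht
  have h1 : ContinuousWithinAt
      (fun s => (2 : ℝ) * (2⁻¹ * ∫ x, ‖Torus.laplacian (u s) x‖ ^ 2)) (Icc a b) t :=
    continuousWithinAt_const.mul
      (h.hasDerivWithinAt_half_integral_norm_laplacian_sq hab ht).continuousWithinAt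
  refine h1.congr (fun s _ => ?_) ?_ <;> ring

/-- **A priori time-integrated `Ḣ^s` bound on the Foias–Guillopé–Temam scale, `1 < s < 2`**
(the fractional squares between the enstrophy rung `∫₀ᵀ‖∇u‖₂² ≤ ‖u₀‖₂²/(2ν)` and the FGT rung
`∫₀ᵀ‖Δu‖₂^{2/3} < ∞`, Robinson–Rodrigo–Sadowski 2016 Lemma 8.15 (8.6), by the Sobolev
interpolation Lemma 1.15; exponent `2/(2s−1)` on `‖u‖_{Ḣ^s}`, the Foias–Guillopé–Temam /
Gibbon-chessboard scaling): on `T³`, for every classical solution of the unforced Navier–Stokes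
equations with `ν > 0` on `[0, T] × T³`, `T > 0`, with mean-zero velocity slices,
`∫₀ᵀ (∑_k |k|^{2s}‖û(t,k)‖²)^{1/(2s−1)} dt`
`≤ (1/(4π²))^{s/(2s−1)} · (1/ν + 27‖u(0)‖₂²/(8π⁴ν⁵))^{(s−1)/(2s−1)} · (T + ‖u(0)‖₂²/(2ν))^{s/(2s−1)}`.
Proof: pointwise `∑|k|^{2s}‖û‖² ≤ (4π²)^{−s} ‖∇u‖₂^{2(2−s)} ‖Δu‖₂^{2(s−1)}`
`≤ (4π²)^{−s} [‖Δu‖₂²/(1+‖∇u‖₂²)²]^{s−1} (1+‖∇u‖₂²)^{s}`; raise to `1/(2s−1)` and apply Hölder in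
time with exponents `(2s−1)/(s−1)`, `(2s−1)/s` to the tree's weighted dissipation bound
`∫₀ᵀ ‖Δu‖₂²/(1+‖∇u‖₂²)² ≤ 1/ν + 27‖u(0)‖₂²/(8π⁴ν⁵)` (`Torus.classicalNS_integral_laplacianSq_div_sq_le`)
and `∫₀ᵀ (1+‖∇u‖₂²) ≤ T + ‖u(0)‖₂²/(2ν)`. A PRIORI for every classical solution (no smallness).
[cite: RobinsonRodrigoSadowskiCUP2016, Lemma 8.15 (8.6) with Lemma 1.15 (1.22)]
[cite: FoiasGuillopeTemam1981, Thm 3.1] -/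
theorem classicalNS_integral_hsSeminorm_rpow_le_of_one_lt (hd : Fintype.card d = 3) {s : ℝ}
    (hs1 : 1 < s) (hs2 : s < 2) {ν T : ℝ} (hν : 0 < ν) (hT : 0 < T)
    {u : ℝ → UnitAddTorus d → EuclideanSpace ℝ d} {p : ℝ → UnitAddTorus d → ℝ}
    (h : Torus.IsClassicalNSSolutionOn (Icc 0 T) ν 0 u p)
    (hmean : ∀ t ∈ Icc 0 T, HasZeroMean (u t)) :
    ∫ t in (0 : ℝ)..T, (∑' k : d → ℤ, freqNormSq k ^ s *
        ‖mFourierCoeff (EuclideanSpace.complexify ∘ u t) k‖ ^ 2) ^ (1 / (2 * s - 1)) ≤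
      (1 / (4 * Real.pi ^ 2)) ^ (s / (2 * s - 1)) *
        (1 / ν + 27 * (∫ x, ‖u 0 x‖ ^ 2) / (8 * Real.pi ^ 4 * ν ^ 5)) ^ ((s - 1) / (2 * s - 1)) *
          (T + (∫ x, ‖u 0 x‖ ^ 2) / (2 * ν)) ^ (s / (2 * s - 1)) := by
  classical
  have hn : (Fintype.card d : ℝ) = 3 := by rw [hd]; norm_num
  have h2s : 0 < 2 * s - 1 := by linarith
  set e : ℝ := 1 / (2 * s - 1) with he
  set A : ℝ := (s - 1) / (2 * s - 1) with hA
  set B : ℝ := s / (2 * s - 1) with hB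
  have he0 : 0 < e := by positivity
  have hA0 : 0 < A := by rw [hA]; exact div_pos (by linarith) h2s
  have hB0 : 0 < B := by rw [hB]; exact div_pos (by linarith) h2s
  have hAB : A + B = 1 := by
    rw [hA, hB, ← add_div, div_eq_one_iff_eq h2s.ne']
    ring
  have hAe : (s - 1) * e = A := by rw [hA, he]; ring
  have hBe : s * e = B := by rw [hB, he]; ring
  set X : ℝ → ℝ := fun t => ∑' k : d → ℤ, freqNormSq k ^ s *
    ‖mFourierCoeff (EuclideanSpace.complexify ∘ u t) k‖ ^ 2 with hX
  set G : ℝ → ℝ := fun t => Torus.gradNormSq (u t) with hGdef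
  set P : ℝ → ℝ := fun t => ∫ x, ‖Torus.laplacian (u t) x‖ ^ 2 with hPdef
  set E₀ : ℝ := ∫ x, ‖u 0 x‖ ^ 2 with hE₀
  set c : ℝ := 1 / (4 * Real.pi ^ 2) with hc
  have hc0 : 0 < c := by positivity
  have hG0 : ∀ t, 0 ≤ G t := fun t => Torus.gradNormSq_nonneg _
  have hP0 : ∀ t, 0 ≤ P t := fun t => integral_nonneg fun x => sq_nonneg _
  have h1G : ∀ t, 0 < 1 + G t := fun t => by have := hG0 t; positivity
  have hXnn : ∀ t, 0 ≤ X t := fun t => tsum_nonneg fun k =>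
    mul_nonneg (Real.rpow_nonneg (freqNormSq_nonneg k) _) (sq_nonneg _)
  -- the Hölder factors `a = F^A`, `b = H^B`, `F = P/(1+G)²`, `H = 1 + G`
  set F : ℝ → ℝ := fun t => P t / (1 + G t) ^ 2 with hF
  have hF0 : ∀ t, 0 ≤ F t := fun t => div_nonneg (hP0 t) (sq_nonneg _)
  set fa : ℝ → ℝ := fun t => F t ^ A with hfa
  set fb : ℝ → ℝ := fun t => (1 + G t) ^ B with hfb
  have hfa0 : ∀ t, 0 ≤ fa t := fun t => Real.rpow_nonneg (hF0 t) _
  have hfb0 : ∀ t, 0 < fb t := fun t => Real.rpow_pos_of_pos (h1G t) _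
  -- ### pointwise: `X(t)^e ≤ c^{B} · fa t · fb t`
  have hpt : ∀ t ∈ Icc 0 T, X t ^ e ≤ c ^ B * (fa t * fb t) := by
    intro t ht
    have hut : IsSmooth (u t) := h.smooth_velocity.isSmooth_slice ht
    have h1 := tsum_rpow_mul_norm_sq_le_enstrophy_interpolate hut hs1 hs2
    -- `X ≤ c^{2−s} G^{2−s} · (c²)^{s−1} P^{s−1} = c^s G^{2−s} P^{s−1}`
    have hGc' : G t / (4 * Real.pi ^ 2) = c * G t := by rw [hc]; ring
    have hPc' : P t / (16 * Real.pi ^ 4) = c ^ 2 * P t := by rw [hc]; field_simp; ring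
    have h2 : X t ≤ c ^ s * (G t ^ (2 - s) * P t ^ (s - 1)) := by
      have h1' : X t ≤ (c * G t) ^ (2 - s) * (c ^ 2 * P t) ^ (s - 1) := by
        have := h1; rwa [hGc', hPc'] at this
      refine h1'.trans (le_of_eq ?_)
      rw [Real.mul_rpow hc0.le (hG0 t), Real.mul_rpow (sq_nonneg c) (hP0 t),
        show (c ^ 2) ^ (s - 1) = c ^ (2 * (s - 1)) by
          rw [show c ^ 2 = c ^ (2 : ℝ) from (Real.rpow_two c).symm, ← Real.rpow_mul hc0.le]]
      have ecs : c ^ (2 - s) * c ^ (2 * (s - 1)) = c ^ s := by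
        rw [← Real.rpow_add hc0]; congr 1; ring
      calc c ^ (2 - s) * G t ^ (2 - s) * (c ^ (2 * (s - 1)) * P t ^ (s - 1))
          = (c ^ (2 - s) * c ^ (2 * (s - 1))) * (G t ^ (2 - s) * P t ^ (s - 1)) := by ring
        _ = c ^ s * (G t ^ (2 - s) * P t ^ (s - 1)) := by rw [ecs]
    -- `G^{2−s} P^{s−1} ≤ F^{s−1} (1+G)^{s}`
    have h3 : G t ^ (2 - s) * P t ^ (s - 1) ≤ F t ^ (s - 1) * (1 + G t) ^ s := by
      have hPF : P t = F t * (1 + G t) ^ 2 := by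
        rw [hF]; simp only; rw [div_mul_cancel₀ _ (pow_ne_zero 2 (h1G t).ne')]
      have hG1 : G t ^ (2 - s) ≤ (1 + G t) ^ (2 - s) :=
        Real.rpow_le_rpow (hG0 t) (by linarith) (by linarith)
      calc G t ^ (2 - s) * P t ^ (s - 1)
          ≤ (1 + G t) ^ (2 - s) * P t ^ (s - 1) :=
            mul_le_mul_of_nonneg_right hG1 (Real.rpow_nonneg (hP0 t) _)
        _ = (1 + G t) ^ (2 - s) * (F t ^ (s - 1) * ((1 + G t) ^ 2) ^ (s - 1)) := by
            rw [hPF, Real.mul_rpow (hF0 t) (sq_nonneg _)]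
        _ = F t ^ (s - 1) * ((1 + G t) ^ (2 - s) * (1 + G t) ^ (2 * (s - 1))) := by
            rw [show ((1 + G t) ^ 2) ^ (s - 1) = (1 + G t) ^ (2 * (s - 1)) by
              rw [show (1 + G t) ^ 2 = (1 + G t) ^ (2 : ℝ) from (Real.rpow_two _).symm,
                ← Real.rpow_mul (h1G t).le]]
            ring
        _ = F t ^ (s - 1) * (1 + G t) ^ s := by
            rw [← Real.rpow_add (h1G t)]; congr 2; ring
    have h4 : X t ≤ c ^ s * (F t ^ (s - 1) * (1 + G t) ^ s) :=
      h2.trans (mul_le_mul_of_nonneg_left h3 (Real.rpow_nonneg hc0.le _))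
    have h5 : 0 ≤ c ^ s * (F t ^ (s - 1) * (1 + G t) ^ s) :=
      mul_nonneg (Real.rpow_nonneg hc0.le _)
        (mul_nonneg (Real.rpow_nonneg (hF0 t) _) (Real.rpow_nonneg (h1G t).le _))
    calc X t ^ e ≤ (c ^ s * (F t ^ (s - 1) * (1 + G t) ^ s)) ^ e :=
          Real.rpow_le_rpow (hXnn t) h4 he0.le
      _ = c ^ B * (fa t * fb t) := by
          rw [Real.mul_rpow (Real.rpow_nonneg hc0.le _)
              (mul_nonneg (Real.rpow_nonneg (hF0 t) _) (Real.rpow_nonneg (h1G t).le _)),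
            Real.mul_rpow (Real.rpow_nonneg (hF0 t) _) (Real.rpow_nonneg (h1G t).le _),
            ← Real.rpow_mul hc0.le, ← Real.rpow_mul (hF0 t), ← Real.rpow_mul (h1G t).le,
            hBe, hAe]
  -- ### continuity and Hölder in time on `(0, T]`
  have hGc : ContinuousOn G (Icc 0 T) := continuousOn_gradNormSq' hT h
  have hPc : ContinuousOn P (Icc 0 T) := continuousOn_laplacianSq' hT h
  have h1Gc : ContinuousOn (fun t => 1 + G t) (Icc 0 T) := continuousOn_const.add hGc
  have hFc : ContinuousOn F (Icc 0 T) :=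
    hPc.div (h1Gc.pow 2) fun t _ => pow_ne_zero 2 (h1G t).ne'
  have hfac : ContinuousOn fa (Icc 0 T) := hFc.rpow_const fun t _ => Or.inr hA0.le
  have hfbc : ContinuousOn fb (Icc 0 T) := h1Gc.rpow_const fun t _ => Or.inl (h1G t).ne'
  have hXc : ContinuousOn X (Icc 0 T) :=
    continuousOn_tsum_rpow_mul_norm_sq hT h.smooth_velocity (by linarith) (by rw [hn]; linarith)
  have hXec : ContinuousOn (fun t => X t ^ e) (Icc 0 T) :=
    hXc.rpow_const fun t _ => Or.inr he0.le
  set μ : Measure ℝ := volume.restrict (Ioc 0 T) with hμ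
  haveI : IsFiniteMeasure μ := by rw [hμ]; infer_instance
  have hpq : (1 / A).HolderConjugate (1 / B) := Real.holderConjugate_one_div hA0 hB0 hAB
  have hmemLp : ∀ {f : ℝ → ℝ}, ContinuousOn f (Icc 0 T) → ∀ q : ℝ≥0∞, MemLp f q μ := by
    intro f hf q
    obtain ⟨C, hC⟩ := isCompact_Icc.exists_bound_of_continuousOn hf
    have hmeas : AEStronglyMeasurable f μ :=
      (hf.mono Ioc_subset_Icc_self).aestronglyMeasurable measurableSet_Ioc
    refine MemLp.of_bound hmeas C ?_
    rw [hμ, ae_restrict_iff' measurableSet_Ioc]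
    exact ae_of_all _ fun t ht => hC t (Ioc_subset_Icc_self ht)
  have hH := integral_mul_le_Lp_mul_Lq_of_nonneg (μ := μ) hpq
    (ae_of_all _ fun t => hfa0 t) (ae_of_all _ fun t => (hfb0 t).le)
    (hmemLp hfac _) (hmemLp hfbc _)
  have hfaA : ∀ t, fa t ^ (1 / A) = F t := fun t => by
    rw [hfa]; simp only; rw [← Real.rpow_mul (hF0 t), mul_one_div_cancel hA0.ne', Real.rpow_one]
  have hfbB : ∀ t, fb t ^ (1 / B) = 1 + G t := fun t => by
    rw [hfb]; simp only
    rw [← Real.rpow_mul (h1G t).le, mul_one_div_cancel hB0.ne', Real.rpow_one]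
  have hI1 : ∫ t, fa t * fb t ∂μ = ∫ t in (0 : ℝ)..T, fa t * fb t := by
    rw [intervalIntegral.integral_of_le hT.le, hμ]
  have hI2 : ∫ t, fa t ^ (1 / A) ∂μ = ∫ t in (0 : ℝ)..T, F t := by
    rw [intervalIntegral.integral_of_le hT.le, hμ]
    exact integral_congr_ae (ae_of_all _ fun t => hfaA t)
  have hI3 : ∫ t, fb t ^ (1 / B) ∂μ = ∫ t in (0 : ℝ)..T, (1 + G t) := by
    rw [intervalIntegral.integral_of_le hT.le, hμ]
    exact integral_congr_ae (ae_of_all _ fun t => hfbB t)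
  rw [hI1, hI2, hI3, one_div_one_div, one_div_one_div] at hH
  -- the two a priori bounds
  have hAp := Torus.classicalNS_integral_laplacianSq_div_sq_le hd hν hT h hmean
  have hBp : ∫ t in (0 : ℝ)..T, (1 + G t) ≤ T + E₀ / (2 * ν) := by
    have hGi : IntervalIntegrable G volume 0 T :=
      (hGc.mono (by rw [uIcc_of_le hT.le])).intervalIntegrable
    rw [intervalIntegral.integral_add intervalIntegrable_const hGi, intervalIntegral.integral_const,
      smul_eq_mul, sub_zero, mul_one]
    have hE := Torus.classicalNS_integral_gradNormSq_le hν hT h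
    rw [hE₀]
    linarith
  have hFi0 : 0 ≤ ∫ t in (0 : ℝ)..T, F t :=
    intervalIntegral.integral_nonneg hT.le fun t _ => hF0 t
  have hGi0 : 0 ≤ ∫ t in (0 : ℝ)..T, (1 + G t) :=
    intervalIntegral.integral_nonneg hT.le fun t _ => (h1G t).le
  -- integrate the pointwise bound
  have hIe : IntervalIntegrable (fun t => X t ^ e) volume 0 T :=
    (hXec.mono (by rw [uIcc_of_le hT.le])).intervalIntegrable
  have hIab : IntervalIntegrable (fun t => c ^ B * (fa t * fb t)) volume 0 T :=
    ((continuousOn_const.mul (hfac.mul hfbc)).mono (by rw [uIcc_of_le hT.le])).intervalIntegrable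
  have hmono := intervalIntegral.integral_mono_on hT.le hIe hIab hpt
  have hcB : 0 ≤ c ^ B := Real.rpow_nonneg hc0.le _
  calc ∫ t in (0 : ℝ)..T, X t ^ e
      ≤ ∫ t in (0 : ℝ)..T, c ^ B * (fa t * fb t) := hmono
    _ = c ^ B * ∫ t in (0 : ℝ)..T, fa t * fb t := intervalIntegral.integral_const_mul _ _
    _ ≤ c ^ B * ((∫ t in (0 : ℝ)..T, F t) ^ A * (∫ t in (0 : ℝ)..T, (1 + G t)) ^ B) :=
        mul_le_mul_of_nonneg_left hH hcB
    _ ≤ c ^ B * ((1 / ν + 27 * E₀ / (8 * Real.pi ^ 4 * ν ^ 5)) ^ A * (T + E₀ / (2 * ν)) ^ B) := by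
        refine mul_le_mul_of_nonneg_left ?_ hcB
        exact mul_le_mul (Real.rpow_le_rpow hFi0 hAp hA0.le) (Real.rpow_le_rpow hGi0 hBp hB0.le)
          (Real.rpow_nonneg hGi0 _) (Real.rpow_nonneg (hFi0.trans hAp) _)
    _ = c ^ B * (1 / ν + 27 * E₀ / (8 * Real.pi ^ 4 * ν ^ 5)) ^ A * (T + E₀ / (2 * ν)) ^ B := by
        ring


/-! ### §4 The Foias–Guillopé–Temam scale: `∫₀ᵀ ‖u‖_{Ḣ^s}^{2/(2s−1)}`, `2 < s < 3` -/

/-- **`‖u‖²_{Ḣ^s} ≤ (‖Δu‖₂²/(16π⁴))^{3−s} (‖∇Δu‖₂²/(64π⁶))^{s−2}`** for a smooth field on `T^n` and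
`2 < s < 3` (Robinson–Rodrigo–Sadowski 2016, Lemma 1.15 (1.22) with `s₁ = 2`, `s₂ = 3`,
`θ = 3 − s`, read through `16π⁴∑|k|⁴‖û‖² = ‖Δu‖₂²` and `64π⁶∑|k|⁶‖û‖² = ‖∇Δu‖₂²`).
[cite: RobinsonRodrigoSadowskiCUP2016, Lemma 1.15 (1.22)] -/
theorem tsum_rpow_mul_norm_sq_le_laplacian_interpolate {u : UnitAddTorus d → EuclideanSpace ℝ d}
    (hu : IsSmooth u) {s : ℝ} (hs2 : 2 < s) (hs3 : s < 3) :
    ∑' k : d → ℤ, freqNormSq k ^ s * ‖mFourierCoeff (EuclideanSpace.complexify ∘ u) k‖ ^ 2 ≤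
      ((∫ x, ‖Torus.laplacian u x‖ ^ 2) / (16 * Real.pi ^ 4)) ^ (3 - s) *
        (Torus.gradNormSq (Torus.laplacian u) / (64 * Real.pi ^ 6)) ^ (s - 2) := by
  classical
  set a : (d → ℤ) → ℝ := fun k => ‖mFourierCoeff (EuclideanSpace.complexify ∘ u) k‖ ^ 2 with ha
  have ha0 : ∀ k, 0 ≤ a k := fun k => sq_nonneg _
  have hP := hasSum_freqNormSq_sq_mul_norm_sq_mFourierCoeff hu
  have hP' : HasSum (fun k : d → ℤ => freqNormSq k ^ (2 : ℝ) * a k)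
      ((∫ x, ‖Torus.laplacian u x‖ ^ 2) / (16 * Real.pi ^ 4)) := by
    have h := hP.mul_left (1 / (16 * Real.pi ^ 4))
    rw [show (∫ x, ‖Torus.laplacian u x‖ ^ 2) / (16 * Real.pi ^ 4) =
      1 / (16 * Real.pi ^ 4) * ∫ x, ‖Torus.laplacian u x‖ ^ 2 by ring]
    refine h.congr_fun fun k => ?_
    simp only [ha]
    rw [Real.rpow_two]
    field_simp
    ring
  -- `64π⁶ ∑|k|⁶‖û‖² = ‖∇Δu‖₂²`: the spectral enstrophy of `Δu`, `𝓕(Δu)(k) = −4π²|k|² û(k)`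
  have hQ := hasSum_freqNormSq_mul_norm_sq_mFourierCoeff hu.laplacian
  have hQ' : HasSum (fun k : d → ℤ => freqNormSq k ^ (3 : ℝ) * a k)
      (Torus.gradNormSq (Torus.laplacian u) / (64 * Real.pi ^ 6)) := by
    have h := hQ.mul_left (1 / (64 * Real.pi ^ 6))
    rw [show Torus.gradNormSq (Torus.laplacian u) / (64 * Real.pi ^ 6) =
      1 / (64 * Real.pi ^ 6) * Torus.gradNormSq (Torus.laplacian u) by ring]
    refine h.congr_fun fun k => ?_
    simp only [ha]
    rw [mFourierCoeff_complexify_laplacian hu, norm_neg, norm_smul, Complex.norm_real,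
      Real.norm_of_nonneg (by have := freqNormSq_nonneg k; positivity),
      show (3 : ℝ) = ((3 : ℕ) : ℝ) by norm_num, Real.rpow_natCast]
    field_simp
    ring
  have h₁ : Summable fun k : d → ℤ => freqNormSq k ^ (2 : ℝ) * a k := hP'.summable
  have h₂ : Summable fun k : d → ℤ => freqNormSq k ^ (3 : ℝ) * a k := hQ'.summable
  obtain ⟨-, hle⟩ := tsum_rpow_mul_le_interpolate (d := d) ha0 (s₁ := 2) (s₂ := 3) (θ := 3 - s)
    zero_le_two (by norm_num) (by linarith) (by linarith) h₁ h₂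
  have e : (3 - s) * 2 + (1 - (3 - s)) * 3 = s := by ring
  rw [e, hP'.tsum_eq, hQ'.tsum_eq, show (1 : ℝ) - (3 - s) = s - 2 by ring] at hle
  exact hle

/-- Along a classical solution on `[a, b]`, `t ↦ ‖∇Δu(t)‖₂²` is continuous (from the `H³`
balance `Torus.IsClassicalNSSolutionOn.hasDerivWithinAt_half_gradNormSq_laplacian_iterate`).
[folklore] -/
private theorem continuousOn_gradNormSq_laplacian' {ν a b : ℝ} (hab : a < b)
    {f u : ℝ → UnitAddTorus d → EuclideanSpace ℝ d} {p : ℝ → UnitAddTorus d → ℝ}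
    (h : Torus.IsClassicalNSSolutionOn (Icc a b) ν f u p) :
    ContinuousOn (fun t => Torus.gradNormSq (Torus.laplacian (u t))) (Icc a b) := by
  intro t ht
  have h0 := (h.hasDerivWithinAt_half_gradNormSq_laplacian_iterate hab 1 ht).continuousWithinAt
  have h1 : ContinuousWithinAt
      (fun s => (2 : ℝ) * (2⁻¹ * Torus.gradNormSq (Torus.laplacian^[1] (u s)))) (Icc a b) t :=
    continuousWithinAt_const.mul h0
  simp only [Function.iterate_one] at h1
  refine h1.congr (fun s _ => ?_) ?_ <;> ring

/-- **A priori time-integrated `Ḣ^s` bound on the Foias–Guillopé–Temam scale, `2 < s < 3`**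
(the fractional squares between the FGT rungs `∫₀ᵀ‖Δu‖₂^{2/3}` and `∫₀ᵀ‖∇Δu‖₂^{2/5}`,
Foias–Guillopé–Temam 1981 Thm 3.1 / Gibbon's chessboard, by the Sobolev interpolation Lemma 1.15;
exponent `2/(2s−1)` on `‖u‖_{Ḣ^s}`): on `T³`, for every classical solution of the unforced
Navier–Stokes equations with `ν > 0` on `[0, T] × T³`, `T > 0`, with mean-zero velocity slices,
with `Y₁ = 1/ν + 27‖u(0)‖₂²/(8π⁴ν⁵)`, `B₂ = Y₁^{1/3}(T + ‖u(0)‖₂²/(2ν))^{2/3}` and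
`W₃ = 3 + (3/2)(3√2/π)^{4/3}(2ν)^{−1/3} B₂` (the tree's weighted `H³` dissipation bound
`ν∫₀ᵀ ‖∇Δu‖₂²/(1+‖Δu‖₂²)^{4/3} ≤ W₃`, `Torus.classicalNS_integral_gradNormSq_laplacian_div_le`),
`∫₀ᵀ (∑_k |k|^{2s}‖û(t,k)‖²)^{1/(2s−1)} dt ≤ (1/(4π²))^{s/(2s−1)} (W₃/ν)^{(s−2)/(2s−1)} (T + B₂)^{(s+1)/(2s−1)}`.
Proof: pointwise `∑|k|^{2s}‖û‖² ≤ (4π²)^{−s} ‖Δu‖₂^{2(3−s)} ‖∇Δu‖₂^{2(s−2)}`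
`≤ (4π²)^{−s} [‖∇Δu‖₂²/(1+‖Δu‖₂²)^{4/3}]^{s−2} (1+‖Δu‖₂²)^{(s+1)/3}`; raise to `1/(2s−1)`, Hölder in
time with exponents `(2s−1)/(s−2)`, `(2s−1)/(s+1)`, and `(1+P)^{1/3} ≤ 1 + P^{1/3}` with
`∫₀ᵀ‖Δu‖₂^{2/3} ≤ B₂` (`Torus.classicalNS_integral_laplacian_twoThirds_le`). A PRIORI for every
classical solution (no smallness).
[cite: FoiasGuillopeTemam1981, Thm 3.1 (rungs m = 2, 3) with RobinsonRodrigoSadowskiCUP2016 Lemma 1.15]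
[cite: Gibbon2019Chessboard, Appendix A (A.1)] -/
theorem classicalNS_integral_hsSeminorm_rpow_le_of_two_lt (hd : Fintype.card d = 3) {s : ℝ}
    (hs2 : 2 < s) (hs3 : s < 3) {ν T : ℝ} (hν : 0 < ν) (hT : 0 < T)
    {u : ℝ → UnitAddTorus d → EuclideanSpace ℝ d} {p : ℝ → UnitAddTorus d → ℝ}
    (h : Torus.IsClassicalNSSolutionOn (Icc 0 T) ν 0 u p)
    (hmean : ∀ t ∈ Icc 0 T, HasZeroMean (u t)) :
    ∫ t in (0 : ℝ)..T, (∑' k : d → ℤ, freqNormSq k ^ s *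
        ‖mFourierCoeff (EuclideanSpace.complexify ∘ u t) k‖ ^ 2) ^ (1 / (2 * s - 1)) ≤
      (1 / (4 * Real.pi ^ 2)) ^ (s / (2 * s - 1)) *
        ((3 + 3 / 2 * (3 * Real.sqrt 2 / Real.pi) ^ ((4 : ℝ) / 3) * (2 * ν) ^ (-(1 : ℝ) / 3) *
          ((1 / ν + 27 * (∫ x, ‖u 0 x‖ ^ 2) / (8 * Real.pi ^ 4 * ν ^ 5)) ^ ((1 : ℝ) / 3) *
            (T + (∫ x, ‖u 0 x‖ ^ 2) / (2 * ν)) ^ ((2 : ℝ) / 3))) / ν) ^ ((s - 2) / (2 * s - 1)) *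
        (T + (1 / ν + 27 * (∫ x, ‖u 0 x‖ ^ 2) / (8 * Real.pi ^ 4 * ν ^ 5)) ^ ((1 : ℝ) / 3) *
            (T + (∫ x, ‖u 0 x‖ ^ 2) / (2 * ν)) ^ ((2 : ℝ) / 3)) ^ ((s + 1) / (2 * s - 1)) := by
  classical
  have hπ : 0 < Real.pi := Real.pi_pos
  have hn : (Fintype.card d : ℝ) = 3 := by rw [hd]; norm_num
  have h2s : 0 < 2 * s - 1 := by linarith
  set e : ℝ := 1 / (2 * s - 1) with he
  set A : ℝ := (s - 2) / (2 * s - 1) with hA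
  set B : ℝ := (s + 1) / (2 * s - 1) with hB
  have he0 : 0 < e := by positivity
  have hA0 : 0 < A := by rw [hA]; exact div_pos (by linarith) h2s
  have hB0 : 0 < B := by rw [hB]; exact div_pos (by linarith) h2s
  have hAB : A + B = 1 := by
    rw [hA, hB, ← add_div, div_eq_one_iff_eq h2s.ne']
    ring
  have hAe : (s - 2) * e = A := by rw [hA, he]; ring
  have hBe : (s + 1) / 3 * e = B * (1 / 3) := by rw [hB, he]; ring
  -- the a priori constants
  set E₀ : ℝ := ∫ x, ‖u 0 x‖ ^ 2 with hE₀
  have hE₀0 : 0 ≤ E₀ := integral_nonneg fun x => sq_nonneg _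
  set B₂ : ℝ := (1 / ν + 27 * E₀ / (8 * Real.pi ^ 4 * ν ^ 5)) ^ ((1 : ℝ) / 3) *
    (T + E₀ / (2 * ν)) ^ ((2 : ℝ) / 3) with hB₂
  set W : ℝ := 3 + 3 / 2 * (3 * Real.sqrt 2 / Real.pi) ^ ((4 : ℝ) / 3) * (2 * ν) ^ (-(1 : ℝ) / 3) * B₂
    with hW
  have hB₂0 : 0 ≤ B₂ := by positivity
  have hW0 : 0 ≤ W := by positivity
  set X : ℝ → ℝ := fun t => ∑' k : d → ℤ, freqNormSq k ^ s *
    ‖mFourierCoeff (EuclideanSpace.complexify ∘ u t) k‖ ^ 2 with hX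
  set P : ℝ → ℝ := fun t => ∫ x, ‖Torus.laplacian (u t) x‖ ^ 2 with hPdef
  set Q : ℝ → ℝ := fun t => Torus.gradNormSq (Torus.laplacian (u t)) with hQdef
  set c : ℝ := 1 / (4 * Real.pi ^ 2) with hc
  have hc0 : 0 < c := by positivity
  have hP0 : ∀ t, 0 ≤ P t := fun t => integral_nonneg fun x => sq_nonneg _
  have hQ0 : ∀ t, 0 ≤ Q t := fun t => Torus.gradNormSq_nonneg _
  have h1P : ∀ t, 0 < 1 + P t := fun t => by have := hP0 t; positivity
  have hXnn : ∀ t, 0 ≤ X t := fun t => tsum_nonneg fun k =>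
    mul_nonneg (Real.rpow_nonneg (freqNormSq_nonneg k) _) (sq_nonneg _)
  -- the Hölder factors `fa = F^A`, `fb = ((1+P)^{1/3})^B`, `F = Q/(1+P)^{4/3}`
  set F : ℝ → ℝ := fun t => Q t / (1 + P t) ^ ((4 : ℝ) / 3) with hF
  have hF0 : ∀ t, 0 ≤ F t := fun t => div_nonneg (hQ0 t) (Real.rpow_nonneg (h1P t).le _)
  set H : ℝ → ℝ := fun t => (1 + P t) ^ ((1 : ℝ) / 3) with hH
  have hH0 : ∀ t, 0 < H t := fun t => Real.rpow_pos_of_pos (h1P t) _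
  set fa : ℝ → ℝ := fun t => F t ^ A with hfa
  set fb : ℝ → ℝ := fun t => H t ^ B with hfb
  have hfa0 : ∀ t, 0 ≤ fa t := fun t => Real.rpow_nonneg (hF0 t) _
  have hfb0 : ∀ t, 0 < fb t := fun t => Real.rpow_pos_of_pos (hH0 t) _
  -- ### pointwise: `X(t)^e ≤ c^{sе} · fa t · fb t`
  have hpt : ∀ t ∈ Icc 0 T, X t ^ e ≤ c ^ (s * e) * (fa t * fb t) := by
    intro t ht
    have hut : IsSmooth (u t) := h.smooth_velocity.isSmooth_slice ht
    have h1 := tsum_rpow_mul_norm_sq_le_laplacian_interpolate hut hs2 hs3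
    have hPc' : P t / (16 * Real.pi ^ 4) = c ^ 2 * P t := by rw [hc]; field_simp; ring
    have hQc' : Q t / (64 * Real.pi ^ 6) = c ^ 3 * Q t := by rw [hc]; field_simp; ring
    have h2 : X t ≤ c ^ s * (P t ^ (3 - s) * Q t ^ (s - 2)) := by
      have h1' : X t ≤ (c ^ 2 * P t) ^ (3 - s) * (c ^ 3 * Q t) ^ (s - 2) := by
        have := h1; rwa [hPc', hQc'] at this
      refine h1'.trans (le_of_eq ?_)
      rw [Real.mul_rpow (pow_nonneg hc0.le 2) (hP0 t), Real.mul_rpow (pow_nonneg hc0.le 3) (hQ0 t),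
        show (c ^ 2) ^ (3 - s) = c ^ (2 * (3 - s)) by
          rw [show c ^ 2 = c ^ (2 : ℝ) from (Real.rpow_two c).symm, ← Real.rpow_mul hc0.le],
        show (c ^ 3) ^ (s - 2) = c ^ (3 * (s - 2)) by
          rw [show c ^ 3 = c ^ (3 : ℝ) by rw [show (3 : ℝ) = ((3 : ℕ) : ℝ) by norm_num,
            Real.rpow_natCast], ← Real.rpow_mul hc0.le]]
      have ecs : c ^ (2 * (3 - s)) * c ^ (3 * (s - 2)) = c ^ s := by
        rw [← Real.rpow_add hc0]; congr 1; ring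
      calc c ^ (2 * (3 - s)) * P t ^ (3 - s) * (c ^ (3 * (s - 2)) * Q t ^ (s - 2))
          = (c ^ (2 * (3 - s)) * c ^ (3 * (s - 2))) * (P t ^ (3 - s) * Q t ^ (s - 2)) := by ring
        _ = c ^ s * (P t ^ (3 - s) * Q t ^ (s - 2)) := by rw [ecs]
    -- `P^{3−s} Q^{s−2} ≤ F^{s−2} (1+P)^{(s+1)/3}`
    have h3 : P t ^ (3 - s) * Q t ^ (s - 2) ≤ F t ^ (s - 2) * (1 + P t) ^ ((s + 1) / 3) := by
      have hQF : Q t = F t * (1 + P t) ^ ((4 : ℝ) / 3) := by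
        rw [hF]; simp only
        rw [div_mul_cancel₀ _ (Real.rpow_pos_of_pos (h1P t) _).ne']
      have hP1 : P t ^ (3 - s) ≤ (1 + P t) ^ (3 - s) :=
        Real.rpow_le_rpow (hP0 t) (by linarith) (by linarith)
      calc P t ^ (3 - s) * Q t ^ (s - 2)
          ≤ (1 + P t) ^ (3 - s) * Q t ^ (s - 2) :=
            mul_le_mul_of_nonneg_right hP1 (Real.rpow_nonneg (hQ0 t) _)
        _ = (1 + P t) ^ (3 - s) * (F t ^ (s - 2) * ((1 + P t) ^ ((4 : ℝ) / 3)) ^ (s - 2)) := by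
            rw [hQF, Real.mul_rpow (hF0 t) (Real.rpow_nonneg (h1P t).le _)]
        _ = F t ^ (s - 2) * ((1 + P t) ^ (3 - s) * (1 + P t) ^ ((4 : ℝ) / 3 * (s - 2))) := by
            rw [← Real.rpow_mul (h1P t).le]
            ring
        _ = F t ^ (s - 2) * (1 + P t) ^ ((s + 1) / 3) := by
            rw [← Real.rpow_add (h1P t)]; congr 2; ring
    have h4 : X t ≤ c ^ s * (F t ^ (s - 2) * (1 + P t) ^ ((s + 1) / 3)) :=
      h2.trans (mul_le_mul_of_nonneg_left h3 (Real.rpow_nonneg hc0.le _))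
    calc X t ^ e ≤ (c ^ s * (F t ^ (s - 2) * (1 + P t) ^ ((s + 1) / 3))) ^ e :=
          Real.rpow_le_rpow (hXnn t) h4 he0.le
      _ = c ^ (s * e) * (fa t * fb t) := by
          rw [Real.mul_rpow (Real.rpow_nonneg hc0.le _)
              (mul_nonneg (Real.rpow_nonneg (hF0 t) _) (Real.rpow_nonneg (h1P t).le _)),
            Real.mul_rpow (Real.rpow_nonneg (hF0 t) _) (Real.rpow_nonneg (h1P t).le _),
            ← Real.rpow_mul hc0.le, ← Real.rpow_mul (hF0 t), ← Real.rpow_mul (h1P t).le,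
            hAe, hBe, hfb, hH]
          simp only
          rw [← Real.rpow_mul (h1P t).le, mul_comm (1 / 3 : ℝ) B]
  -- ### continuity and Hölder in time on `(0, T]`
  have hPc : ContinuousOn P (Icc 0 T) := continuousOn_laplacianSq' hT h
  have hQc : ContinuousOn Q (Icc 0 T) := continuousOn_gradNormSq_laplacian' hT h
  have h1Pc : ContinuousOn (fun t => 1 + P t) (Icc 0 T) := continuousOn_const.add hPc
  have hFc : ContinuousOn F (Icc 0 T) :=
    hQc.div (h1Pc.rpow_const fun t _ => Or.inl (h1P t).ne')
      fun t _ => (Real.rpow_pos_of_pos (h1P t) _).ne'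
  have hHc : ContinuousOn H (Icc 0 T) := h1Pc.rpow_const fun t _ => Or.inl (h1P t).ne'
  have hfac : ContinuousOn fa (Icc 0 T) := hFc.rpow_const fun t _ => Or.inr hA0.le
  have hfbc : ContinuousOn fb (Icc 0 T) := hHc.rpow_const fun t _ => Or.inl (hH0 t).ne'
  have hXc : ContinuousOn X (Icc 0 T) :=
    continuousOn_tsum_rpow_mul_norm_sq_of_lt_six hT h.smooth_velocity (by linarith) (by rw [hn]; linarith)
  have hXec : ContinuousOn (fun t => X t ^ e) (Icc 0 T) :=
    hXc.rpow_const fun t _ => Or.inr he0.le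
  set μ : Measure ℝ := volume.restrict (Ioc 0 T) with hμ
  haveI : IsFiniteMeasure μ := by rw [hμ]; infer_instance
  have hpq : (1 / A).HolderConjugate (1 / B) := Real.holderConjugate_one_div hA0 hB0 hAB
  have hmemLp : ∀ {f : ℝ → ℝ}, ContinuousOn f (Icc 0 T) → ∀ q : ℝ≥0∞, MemLp f q μ := by
    intro f hf q
    obtain ⟨C, hC⟩ := isCompact_Icc.exists_bound_of_continuousOn hf
    have hmeas : AEStronglyMeasurable f μ :=
      (hf.mono Ioc_subset_Icc_self).aestronglyMeasurable measurableSet_Ioc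
    refine MemLp.of_bound hmeas C ?_
    rw [hμ, ae_restrict_iff' measurableSet_Ioc]
    exact ae_of_all _ fun t ht => hC t (Ioc_subset_Icc_self ht)
  have hHo := integral_mul_le_Lp_mul_Lq_of_nonneg (μ := μ) hpq
    (ae_of_all _ fun t => hfa0 t) (ae_of_all _ fun t => (hfb0 t).le)
    (hmemLp hfac _) (hmemLp hfbc _)
  have hfaA : ∀ t, fa t ^ (1 / A) = F t := fun t => by
    rw [hfa]; simp only; rw [← Real.rpow_mul (hF0 t), mul_one_div_cancel hA0.ne', Real.rpow_one]
  have hfbB : ∀ t, fb t ^ (1 / B) = H t := fun t => by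
    rw [hfb]; simp only
    rw [← Real.rpow_mul (hH0 t).le, mul_one_div_cancel hB0.ne', Real.rpow_one]
  have hI1 : ∫ t, fa t * fb t ∂μ = ∫ t in (0 : ℝ)..T, fa t * fb t := by
    rw [intervalIntegral.integral_of_le hT.le, hμ]
  have hI2 : ∫ t, fa t ^ (1 / A) ∂μ = ∫ t in (0 : ℝ)..T, F t := by
    rw [intervalIntegral.integral_of_le hT.le, hμ]
    exact integral_congr_ae (ae_of_all _ fun t => hfaA t)
  have hI3 : ∫ t, fb t ^ (1 / B) ∂μ = ∫ t in (0 : ℝ)..T, H t := by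
    rw [intervalIntegral.integral_of_le hT.le, hμ]
    exact integral_congr_ae (ae_of_all _ fun t => hfbB t)
  rw [hI1, hI2, hI3, one_div_one_div, one_div_one_div] at hHo
  -- ### the two a priori bounds: `∫ F ≤ W/ν`, `∫ H ≤ T + B₂`
  have hAp : ∫ t in (0 : ℝ)..T, F t ≤ W / ν := by
    rw [le_div_iff₀ hν, mul_comm]
    have := Torus.classicalNS_integral_gradNormSq_laplacian_div_le hd hν hT h hmean
    simpa [hW, hB₂, hE₀] using this
  have hBp : ∫ t in (0 : ℝ)..T, H t ≤ T + B₂ := by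
    have h13 : ∀ t, H t ≤ 1 + P t ^ ((1 : ℝ) / 3) := fun t => by
      have := Real.rpow_add_le_add_rpow zero_le_one (hP0 t) (by norm_num : (0 : ℝ) ≤ 1 / 3)
        (by norm_num)
      simpa [hH] using this
    have hP13c : ContinuousOn (fun t => P t ^ ((1 : ℝ) / 3)) (Icc 0 T) :=
      hPc.rpow_const fun t _ => Or.inr (by norm_num)
    have hP13i : IntervalIntegrable (fun t => P t ^ ((1 : ℝ) / 3)) volume 0 T :=
      (hP13c.mono (by rw [uIcc_of_le hT.le])).intervalIntegrable
    have hmono : ∫ t in (0 : ℝ)..T, H t ≤ ∫ t in (0 : ℝ)..T, (1 + P t ^ ((1 : ℝ) / 3)) :=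
      intervalIntegral.integral_mono_on hT.le ((hHc.mono (by rw [uIcc_of_le hT.le])).intervalIntegrable)
        (intervalIntegrable_const.add hP13i) fun t _ => h13 t
    rw [intervalIntegral.integral_add intervalIntegrable_const hP13i, intervalIntegral.integral_const,
      smul_eq_mul, sub_zero, mul_one] at hmono
    have hE := Torus.classicalNS_integral_laplacian_twoThirds_le hd hν hT h hmean
    have hE' : ∫ t in (0 : ℝ)..T, P t ^ ((1 : ℝ) / 3) ≤ B₂ := by
      rw [hB₂, hE₀]; exact hE
    linarith
  have hFi0 : 0 ≤ ∫ t in (0 : ℝ)..T, F t :=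
    intervalIntegral.integral_nonneg hT.le fun t _ => hF0 t
  have hHi0 : 0 ≤ ∫ t in (0 : ℝ)..T, H t :=
    intervalIntegral.integral_nonneg hT.le fun t _ => (hH0 t).le
  -- integrate the pointwise bound
  have hIe : IntervalIntegrable (fun t => X t ^ e) volume 0 T :=
    (hXec.mono (by rw [uIcc_of_le hT.le])).intervalIntegrable
  have hIab : IntervalIntegrable (fun t => c ^ (s * e) * (fa t * fb t)) volume 0 T :=
    ((continuousOn_const.mul (hfac.mul hfbc)).mono (by rw [uIcc_of_le hT.le])).intervalIntegrable
  have hmono := intervalIntegral.integral_mono_on hT.le hIe hIab hpt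
  have hcB : 0 ≤ c ^ (s * e) := Real.rpow_nonneg hc0.le _
  have hse : s * e = s / (2 * s - 1) := by rw [he]; ring
  calc ∫ t in (0 : ℝ)..T, X t ^ e
      ≤ ∫ t in (0 : ℝ)..T, c ^ (s * e) * (fa t * fb t) := hmono
    _ = c ^ (s * e) * ∫ t in (0 : ℝ)..T, fa t * fb t := intervalIntegral.integral_const_mul _ _
    _ ≤ c ^ (s * e) * ((∫ t in (0 : ℝ)..T, F t) ^ A * (∫ t in (0 : ℝ)..T, H t) ^ B) :=
        mul_le_mul_of_nonneg_left hHo hcB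
    _ ≤ c ^ (s * e) * ((W / ν) ^ A * (T + B₂) ^ B) := by
        refine mul_le_mul_of_nonneg_left ?_ hcB
        exact mul_le_mul (Real.rpow_le_rpow hFi0 hAp hA0.le) (Real.rpow_le_rpow hHi0 hBp hB0.le)
          (Real.rpow_nonneg hHi0 _) (Real.rpow_nonneg (hFi0.trans hAp) _)
    _ = c ^ (s / (2 * s - 1)) * (W / ν) ^ A * (T + B₂) ^ B := by rw [hse]; ring


end NSSobolev

end Literature.Analysis.FluidPDE

end
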